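import Literature.NumberTheory.ModularForms.DedekindEtaLogTransformationProofs
import Summits.BirchSwinnertonDyer.BirchSwinnertonDyer.Theorems.EisensteinDepletionAtTwoStarKummerDoorC
import HarnessLib

/-!
# Line `kummer` v7.4, print stub K-D `stub_dedekindEtaLog` — CLOSED (crux `StarGO2Sigma`, stmt-BirchSwinnertonDyer-27046; lead GEN 13)

The registered print stub `stub_dedekindEtaLog : Literature.NumberTheory.ModularForms.dedekindEta_logTransformationLaw` is the
tree theorem `Literature.NumberTheory.ModularForms.dedekindEta_logTransformationLaw_holds` (planner p2 GEN 39's kernel, landed as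
`Literature/NumberTheory/ModularForms/DedekindEtaLogTransformationProofs.lean`).  Consequence for the door (part C): the route item
`StarGO2Sigma` (27046) from THREE prints (Carayol, Edixhoven ∧ Abbes–Ullmo, Calegari–Dimitrov–Tang) and the split parent E1M_NSF (27021)
from TWO prints and the sibling `StarOptBNSF`.  CONDITIONAL RESULTS; nothing here reads an analytic rank; `StarGO2Sigma`, E1M_NSF, E1M
and BSD are NOT proved (PARTITION D-0054: none — r_an ≥ 2, axis S0).
-/

set_option linter.dupNamespace false
set_option autoImplicit false

namespace Summit.BirchSwinnertonDyer.BirchSwinnertonDyer.Theorems.DepletionAtTwo.KummerPrints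

/-- **Print stub K-D `stub_dedekindEtaLog` of line `kummer` v7.4 (registered signature verbatim) — CLOSED** by the tree's proof of
the named fact. [cite: Apostol1990, Thm. 3.4] [cite: RademacherGrosswald1972, Ch. 4 A, eq. (60)] -/
theorem stub_dedekindEtaLog : Literature.NumberTheory.ModularForms.dedekindEta_logTransformationLaw :=
  Literature.NumberTheory.ModularForms.dedekindEta_logTransformationLaw_holds

end Summit.BirchSwinnertonDyer.BirchSwinnertonDyer.Theorems.DepletionAtTwo.KummerPrints

namespace Summit.BirchSwinnertonDyer.BirchSwinnertonDyer.Theorems.DepletionAtTwo.KummerDoor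

/-- **END STATE of line `kummer` after K-D: the route item `StarGO2Sigma` (27046) from THREE PRINTS** — Carayol
(`stub_levelEqConductor`), Edixhoven ∧ Abbes–Ullmo (`stub_maninPrint`), Calegari–Dimitrov–Tang (`stub_ubd`).  CONDITIONAL RESULT.
[cite: Stevens1982, §2.5] -/
theorem starGO2Sigma_of_three_prints (h4 : stub_levelEqConductor) (hMP : stub_maninPrint) (hU : stub_ubd) :
    Summit.BirchSwinnertonDyer.BirchSwinnertonDyer.Theses.EisensteinDepletionAtTwo.StarGO2Sigma :=
  starGO2Sigma_of_prints h4 KummerPrints.stub_dedekindEtaLog hMP hU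

/-- **END STATE for the split parent E1M_NSF (27021) after K-D**: from the prints Manin and UBD and the sibling child `StarOptBNSF`
(27047).  CONDITIONAL RESULT. [cite: GreenbergVatsal2000, §3 Thm. (3.12)] -/
theorem depletedLambdaLawAtTwoModNSF_of_two_prints (hMP : stub_maninPrint) (hU : stub_ubd)
    (hO : Summit.BirchSwinnertonDyer.BirchSwinnertonDyer.Theses.EisensteinDepletionAtTwo.StarOptBNSF) :
    Summit.BirchSwinnertonDyer.BirchSwinnertonDyer.Theses.EisensteinDepletionAtTwo.DepletedLambdaLawAtTwoModNSF :=
  depletedLambdaLawAtTwoModNSF_of_prints KummerPrints.stub_dedekindEtaLog hMP hU hO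

end Summit.BirchSwinnertonDyer.BirchSwinnertonDyer.Theorems.DepletionAtTwo.KummerDoor
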